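import Literature.MathematicalPhysics.QuantumFieldTheory.Balaban1983to89.T4AdInvariant
import Literature.MathematicalPhysics.QuantumFieldTheory.Balaban1983to89.T4GatedBooking

/-!
# T4CoReadMoment — the MOMENT seam for the co-read pair channel: zero mean of the commutator insert under a
conjugation-invariant law, second-cumulant booking of a centred perturbation, and the two booking lines of Q17 (a)
(cell `pub-balaban`, T4-DAG v5 §8 Q17 / §5 rows T4-O3.E-iii-b (owner) and T4-NE1ii-BIRTH (pv05 lineage); self-assigned
KERNEL row T4-O3.E-iii-b-M of the pv28 lineage; kernel bookkeeping, Mathlib + two cell modules BY NAME)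

HONEST FRAMING (cell `pub-balaban`, T4-DAG PAGE 1).  The cell's T4 target is the existence AND uniqueness of the
continuum limit of Bałaban's unit-scale averaged loop expectations on a finite torus — a constructive-QFT statement
strictly beyond ultraviolet stability ([Balaban1989LargeFieldII] Thm 1 p. 355); it is NOT the Yang–Mills mass gap and NOT
the Clay problem.  This module is ELEMENTARY and asserts NOTHING about Bałaban's papers: no statement of the series B1–B16
is quoted, used or typed here.  It supplies, BY NAME, the three kernel facts behind the BOOKING DECISION that T4-DAG v5 §8
Q17 asks of the O3.E-iii-b owner (record `t4/T4-EST-O3Eiiib.md` v2 §4bis): the CO-READ pair channel of `W_C ∘ avgⁿ`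
(two fine bonds first read by the same coarse-bond formula of the block averaging, [Balaban1985Averaging] (15) p. 19 —
LOCATOR ONLY (v1.1: v1 wrote «p. 21», a slip inherited from T4-DAG v5; (15) is printed on journal p. 19, render
read as image; cell DIVERGENCE D-pv28g5.1), nothing of it is typed here; the one-step laws are row T4-NE1ii-BIRTH's,
pv05 lineage) is first-order sized per level with a colour-ANTISYMMETRIC (commutator / ε) structure (cell toy engines,
`t4/T4-RUNG-O3c1.md` §3.3, `t4/T4-RUNG-O3c1-B2.md` §9; [toy-located], not used here), and Q17 (a) asks whether such
pieces are booked by a SUP bound (count × size line `(Λθ₁)^{K−j}`, `Λ = L⁴`, divergent at `θ₁ = L⁻³`) or through their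
conditional MEAN and SECOND MOMENT (variance line `(Λθ₁²)^{K−j} = L^{−2(K−j)}`, summable).  Every declaration is
`[folklore]`.  Value: kernel lemma + the arithmetic of a booking decision, NOT summit progress.

## Contents

* §1 (K9) ZERO MEAN OF THE COMMUTATOR INSERT.  In the vocabulary of `T4AdInvariant` §3 (values in
  `Fin 2 → Fin 2 → ℂ`, `conjOp`, the hypothesis shape (k3) `FlatExteriorConjInvariant μ T` and the equivariance shape
  `ConjEquivariant T f`): the matrix PRODUCT of two conjugation-equivariant inserts is conjugation-equivariant
  (`conjEquivariant_mprod` — because `h⋆h = 1`), hence so is their COMMUTATOR (`conjEquivariant_mcomm`), and a commutator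
  is pointwise traceless (`trace_mcomm`, `Matrix.trace_mul_comm`); therefore `∫ (f·g − g·f) ∂μ = 0`
  (`integral_mcomm_eq_zero`, from `T4AdInvariant.integral_eq_zero_of_conjEquivariant`; NO integrability hypothesis and
  NO tracelessness of `f`, `g` themselves), and `∫ ℓ (f·g − g·f) ∂μ = 0` for EVERY FIXED continuous ℝ-linear
  contraction `ℓ` under the honest integrability binder (`integral_clm_mcomm_eq_zero`) — in particular for the
  contraction against a FIXED exterior direction (the ε_{aa′c}·Θ̂₀^c pattern of the toy records), which need NOT be
  rotated.  Family form over bond pairs: the PAIR MEAN FIELD `pairMeanField P B (b, b′) = ∫ [B ω b, B ω b′] dP(ω)`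
  vanishes identically when every insert `ω ↦ B ω b` is equivariant (`pairMeanField_eq_zero`) — the pair analogue of
  `T4FirstOrderSize.MeanVanishes` at a flat exterior; off flat only a Lipschitz modulus is available
  (`pairMean_norm_le_of_lipschitz`, the pair twin of `T4FirstOrderSize.condMeanSuppression_of_flat`), see CAVEAT.
  Upshot for Q17: «zero conditional mean under a colour-symmetric covariance» is NOT a new named hypothesis of NE1′ — it
  is REDUCED to the existing shape (k3) (row T4-O3.E-i′ (α)'s question, modules `T4FlatExteriorInvariance` /
  `T4NestedCovariance`) plus equivariance of the two inserts.
* §2 (K10) SECOND-CUMULANT BOOKING OF A CENTRED BOUNDED PERTURBATION (Mathlib only).  For a probability measure `μ`, a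
  strongly measurable real `V` with `|V| ≤ 1` pointwise and `∫ V ∂μ = 0`:
  `1 ≤ ∫ exp(−V) ∂μ ≤ 1 + ∫ V² ∂μ` (`one_le_integral_exp_neg`, `integral_exp_neg_le`; `Real.add_one_le_exp`,
  `Real.abs_exp_sub_one_sub_id_le`) and hence `0 ≤ log ∫ exp(−V) ∂μ ≤ ∫ V² ∂μ` (`log_integral_exp_neg_nonneg`,
  `log_integral_exp_neg_le_sq`): a centred first-order-sized fluctuation term moves the effective action
  `−log ∫ e^{−V}` only at SECOND order — the primitive of the «moment / conditional-mean» booking (applied at a fixed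
  exterior, `μ` = the conditional law).  General amplitudes rescale into `|V| ≤ 1`; nothing finer (cluster-expansion
  decoupling of distant pairs) is claimed.
* §3 (K11) THE TWO LINES OF Q17 (a) as array arithmetic (no `Booking` structure; cf. `T4PreservedUnderT.twoRate`,
  `T4PreservedUnderT.sum_count_twoRate_le`, `T4GatedBooking.sum_count_mul_size_le_geom`): with positional counts
  `N j ≤ N₀·Λ^{k−j}` of level-`j` births seen in a level-`k` cube and per-item sizes `A·φ^{k−j}·τ^{K−j}`,
  (a) the VARIANCE LINE — sizes `A·(τ²)^{K−j}`, NO per-step gain (`φ = 1`) — is K-uniform as soon as `Λτ² ≤ r < 1`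
  (`varianceLine_le`: `Σ_{j ≤ k} N j·A(τ²)^{K−j} ≤ N₀A/(1−r)`; cell values `Λ = L⁴`, `τ = θ₁ = L⁻³`, `Λτ² = L⁻²`);
  (b) the SUP LINE without gain — sizes `A·τ^{K−j}` with `Λτ ≥ 1` — has partial sums `≥ (k+1)·N₀Aτ^{K−k}`
  (`supLine_ge`), i.e. `≥ (K+1)·N₀A` at the top cube (`supLine_top_ge`): unbounded in `K` (cell values `Λτ = L ≥ 1`);
  (c) with a per-step gain `φ` the sup line is the two-rate line of `T4PreservedUnderT` (K-uniform iff `Λφτ < 1`,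
  `gainLine_le`) — so the fate of a sup booking of the co-read channel is decided by the SAME flatness-gain question as the
  (S) route's re-linearisation gain (record O-G1/O-G4), while the variance half (a) is unconditional.

CAVEAT (recorded as located obligation O-G7 in `t4/T4-EST-O3Eiiib.md` v2): at a CURVED exterior the conditional law is
at best invariant under the stabiliser of the exterior direction `Θ̂₀`, under which the mean of `[B, B′]` may keep a
`Θ̂₀`-component — exactly the component the ε-structure contracts against.  Off flat the zero mean is therefore NOT a
symmetry consequence; only the Lipschitz suppression `‖m₂(u)(b,b′)‖ ≤ lip·dev u` (§1, hypothesis) is available, ONE MORE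
deviation factor than the single-insert channel carries (the explicit background factor of the co-read coefficient being
the other).  Nothing printed is asserted about either factor.

Interfaces (cell coordination).  SUPPLIERS: (k3) law invariance at fixed exterior ← rows T4-O3.E-i′-Oα / Oα6
(`T4FlatExteriorInvariance.fibreLaw_map_conjFun`, `T4NestedCovariance`); equivariance of the inserts ← the same rows;
the one-step co-read / far laws and their constants ← row T4-NE1ii-BIRTH (pv05 lineage, `t4/T4-EST-NE1iiBirth.md`).
CONSUMERS: the O3.E-iii-b booking (`T4PreservedUnderT`: pair MEANS ride the (S) two-rate array under the same strict
product, pair SECOND CUMULANTS ride the gain-free variance line (a)); row T4-O3.E-ii (the `T4GatedBooking` `Booking.MayerSmallAt` gate;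
pair dressing `T4JointDressing`) for the Mayer-small remainder beyond second order.

What is proved (all [folklore]: matrix algebra over ℂ, invariance of the Bochner integral, `exp`/`log` inequalities,
finite geometric sums).  No `sorry`; standard axioms only.
-/

noncomputable section

open MeasureTheory Finset
open scoped BigOperators

namespace Literature.MathematicalPhysics.QuantumFieldTheory.Balaban1983to89.T4CoReadMoment

open Literature.MathematicalPhysics.QuantumFieldTheory.Balaban1983to89.T4AdInvariant

/-! ## §1 (K9)  Zero mean of the commutator of two conjugation-equivariant inserts -/

section Commutator

variable {X : Type*}

/-- The pointwise MATRIX PRODUCT of two inserts, written in the function type `Fin 2 → Fin 2 → ℂ`. [folklore] -/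
def mprod (f g : X → Fin 2 → Fin 2 → ℂ) : X → Fin 2 → Fin 2 → ℂ :=
  fun x i j => (Matrix.of (f x) * Matrix.of (g x)) i j

/-- The pointwise COMMUTATOR `[f, g] = f·g − g·f` of two inserts (the colour-antisymmetric co-read pair insert of the
cell's toy records, `[B_b, B_b′]`; for 𝔰𝔲(2) ≅ (ℝ³, ×) it is the cross product, i.e. the ε-structure). [folklore] -/
def mcomm (f g : X → Fin 2 → Fin 2 → ℂ) : X → Fin 2 → Fin 2 → ℂ := fun x => mprod f g x - mprod g f x

/-- `Matrix.of (mprod f g x) = of (f x) · of (g x)`. [folklore] -/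
theorem of_mprod (f g : X → Fin 2 → Fin 2 → ℂ) (x : X) :
    Matrix.of (mprod f g x) = Matrix.of (f x) * Matrix.of (g x) := by
  ext i j; rfl

/-- Conjugation is multiplicative when `U⋆U = 1`: `(U F U⋆)(U G U⋆) = U (F G) U⋆`. [folklore] -/
theorem conj_mul_conj (U F G : Matrix (Fin 2) (Fin 2) ℂ) (hU : star U * U = 1) :
    (U * F * star U) * (U * G * star U) = U * (F * G) * star U := by
  have h' : ∀ Y : Matrix (Fin 2) (Fin 2) ℂ, star U * (U * Y) = Y := fun Y => by
    rw [← Matrix.mul_assoc, hU, Matrix.one_mul]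
  simp only [Matrix.mul_assoc, h']

/-- A COMMUTATOR IS TRACELESS, pointwise: `[f,g] x 0 0 + [f,g] x 1 1 = 0` (`Matrix.trace_mul_comm`). [folklore] -/
theorem trace_mcomm (f g : X → Fin 2 → Fin 2 → ℂ) (x : X) : mcomm f g x 0 0 + mcomm f g x 1 1 = 0 := by
  have h := Matrix.trace_mul_comm (Matrix.of (f x)) (Matrix.of (g x))
  rw [Matrix.trace_fin_two, Matrix.trace_fin_two] at h
  simp only [mcomm, mprod, Pi.sub_apply]
  linear_combination h

variable {T : Matrix.specialUnitaryGroup (Fin 2) ℂ → X → X}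

/-- The PRODUCT of two conjugation-equivariant inserts is conjugation-equivariant (`h⋆h = 1` for `h ∈ SU(2)`).
[folklore] -/
theorem conjEquivariant_mprod {f g : X → Fin 2 → Fin 2 → ℂ} (hf : ConjEquivariant T f) (hg : ConjEquivariant T g) :
    ConjEquivariant T (mprod f g) := by
  intro h x
  -- `Matrix.of (conjOp U v) = U · of v · U⋆` holds by `rfl` (cf. `T4NestedCovariance.of_conjOp`, not imported).
  have hf' : Matrix.of (f (T h x)) = (h : Matrix (Fin 2) (Fin 2) ℂ) * Matrix.of (f x) * star (h : Matrix _ _ ℂ) := by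
    rw [hf h x]; exact Matrix.ext fun _ _ => rfl
  have hg' : Matrix.of (g (T h x)) = (h : Matrix (Fin 2) (Fin 2) ℂ) * Matrix.of (g x) * star (h : Matrix _ _ ℂ) := by
    rw [hg h x]; exact Matrix.ext fun _ _ => rfl
  have hU : star (h : Matrix (Fin 2) (Fin 2) ℂ) * (h : Matrix (Fin 2) (Fin 2) ℂ) = 1 := h.prop.1.1
  funext i j
  show (Matrix.of (f (T h x)) * Matrix.of (g (T h x))) i j = conjOp (h : Matrix (Fin 2) (Fin 2) ℂ) (mprod f g x) i j
  rw [hf', hg', conj_mul_conj _ _ _ hU, conjOp_apply, of_mprod]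

/-- The DIFFERENCE of two conjugation-equivariant inserts is conjugation-equivariant. [folklore] -/
theorem conjEquivariant_sub {f g : X → Fin 2 → Fin 2 → ℂ} (hf : ConjEquivariant T f) (hg : ConjEquivariant T g) :
    ConjEquivariant T (fun x => f x - g x) := by
  intro h x
  show f (T h x) - g (T h x) = _
  rw [hf h x, hg h x, map_sub]

/-- The COMMUTATOR of two conjugation-equivariant inserts is conjugation-equivariant. [folklore] -/
theorem conjEquivariant_mcomm {f g : X → Fin 2 → Fin 2 → ℂ} (hf : ConjEquivariant T f) (hg : ConjEquivariant T g) :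
    ConjEquivariant T (mcomm f g) :=
  conjEquivariant_sub (conjEquivariant_mprod hf hg) (conjEquivariant_mprod hg hf)

variable [MeasurableSpace X] {μ : Measure X}

/-- **(K9) ZERO MEAN OF THE COMMUTATOR INSERT.**  Under the hypothesis shape (k3) `FlatExteriorConjInvariant μ T`
(the law is invariant under simultaneous conjugation — NOT proved for Bałaban's conditional law, row T4-O3.E-i′ (α)) and
conjugation-equivariance of the two inserts, `∫ [f, g] ∂μ = 0`.  No integrability hypothesis and no tracelessness of
`f`, `g`: the commutator is traceless by itself.  This is the kernel half of Q17's «zero conditional mean under a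
colour-symmetric covariance». [folklore] -/
theorem integral_mcomm_eq_zero (hμ : FlatExteriorConjInvariant μ T) {f g : X → Fin 2 → Fin 2 → ℂ}
    (hf : ConjEquivariant T f) (hg : ConjEquivariant T g) : ∫ x, mcomm f g x ∂μ = 0 :=
  integral_eq_zero_of_conjEquivariant hμ (conjEquivariant_mcomm hf hg) (trace_mcomm f g)

/-- (K9), entrywise. [folklore] -/
theorem integral_mcomm_apply_eq_zero (hμ : FlatExteriorConjInvariant μ T) {f g : X → Fin 2 → Fin 2 → ℂ}
    (hf : ConjEquivariant T f) (hg : ConjEquivariant T g) (i j : Fin 2) : (∫ x, mcomm f g x ∂μ) i j = 0 := by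
  rw [integral_mcomm_eq_zero hμ hf hg]; rfl

/-- (K9) CONTRACTED AGAINST A FIXED TENSOR: for every continuous ℝ-linear `ℓ` into a real Banach space — e.g. the real
pairing with a FIXED exterior direction `Θ̂₀` (the ε_{aa′c}B^aB′^{a′}Θ̂₀^c pattern), which is NOT rotated — the
contracted commutator has zero mean, under the honest integrability binder (without it `∫ ℓ ∘ [f,g]` could be a
non-junk integral of a non-integrable vector integrand's shadow). [folklore] -/
theorem integral_clm_mcomm_eq_zero {F : Type*} [NormedAddCommGroup F] [NormedSpace ℝ F] [CompleteSpace F]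
    (hμ : FlatExteriorConjInvariant μ T) {f g : X → Fin 2 → Fin 2 → ℂ} (hf : ConjEquivariant T f)
    (hg : ConjEquivariant T g) (ℓ : (Fin 2 → Fin 2 → ℂ) →L[ℝ] F) (hint : Integrable (mcomm f g) μ) :
    ∫ x, ℓ (mcomm f g x) ∂μ = 0 := by
  rw [ContinuousLinearMap.integral_comp_comm ℓ hint, integral_mcomm_eq_zero hμ hf hg, map_zero]

end Commutator

/-! ### Family form: the pair mean field over bond pairs -/

section PairMeanField

variable {Ω : Type*} [MeasurableSpace Ω] {β : Type*}

/-- The PAIR MEAN FIELD of a fluctuation `B : Ω → (bonds → 𝔰𝔲(2) ⊂ Fin 2 → Fin 2 → ℂ)` under a law `P` (the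
conditional law at a fixed exterior): `m₂ (b, b′) = ∫ [B ω b, B ω b′] dP(ω)` — what the scale integration leaves of the
co-read pair insert before contraction with its (exterior-dependent) coefficient. [folklore] -/
def pairMeanField (P : Measure Ω) (B : Ω → β → Fin 2 → Fin 2 → ℂ) : β × β → Fin 2 → Fin 2 → ℂ :=
  fun p => ∫ ω, mcomm (fun ω => B ω p.1) (fun ω => B ω p.2) ω ∂P

/-- AT A CONJUGATION-INVARIANT LAW THE PAIR MEAN FIELD VANISHES IDENTICALLY (every pair, no finiteness, no
integrability): the pair analogue of `T4FirstOrderSize.MeanVanishes` at a flat exterior, now a CONSEQUENCE of (k3) +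
equivariance rather than a separate hypothesis. [folklore] -/
theorem pairMeanField_eq_zero {P : Measure Ω} {T : Matrix.specialUnitaryGroup (Fin 2) ℂ → Ω → Ω}
    (hP : FlatExteriorConjInvariant P T) {B : Ω → β → Fin 2 → Fin 2 → ℂ}
    (hB : ∀ b, ConjEquivariant T (fun ω => B ω b)) (p : β × β) : pairMeanField P B p = 0 :=
  integral_mcomm_eq_zero hP (hB p.1) (hB p.2)

/-- The same on any finite set of pairs, in the `∀ p ∈ S, m₂ p = 0` shape of `T4FirstOrderSize.MeanVanishes`.
[folklore] -/
theorem pairMeanField_vanishes_on {P : Measure Ω} {T : Matrix.specialUnitaryGroup (Fin 2) ℂ → Ω → Ω}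
    (hP : FlatExteriorConjInvariant P T) {B : Ω → β → Fin 2 → Fin 2 → ℂ}
    (hB : ∀ b, ConjEquivariant T (fun ω => B ω b)) (S : Finset (β × β)) :
    ∀ p ∈ S, pairMeanField P B p = 0 := fun p _ => pairMeanField_eq_zero hP hB p

variable {𝒰 : Type*} {E : Type*} [NormedAddCommGroup E]

/-- OFF FLAT (CAVEAT / O-G7): zero pair mean at the flat reference `u₀` plus a Lipschitz modulus of the exterior-indexed
pair mean field `m₂ : 𝒰 → (β × β) → E` in the deviation `dev` gives `‖m₂ u p‖ ≤ lip·dev u` — the pair twin of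
`T4FirstOrderSize.condMeanSuppression_of_flat`, stated for any normed carrier; the Lipschitz modulus is a HYPOTHESIS
(nothing printed asserted). [folklore] -/
theorem pairMean_norm_le_of_lipschitz {dom : Set 𝒰} {m₂ : 𝒰 → β × β → E} {S : Finset (β × β)} {u₀ : 𝒰}
    {dev : 𝒰 → ℝ} {lip : ℝ} (h0 : ∀ p ∈ S, m₂ u₀ p = 0)
    (hL : ∀ u ∈ dom, ∀ p ∈ S, ‖m₂ u p - m₂ u₀ p‖ ≤ lip * dev u) :
    ∀ u ∈ dom, ∀ p ∈ S, ‖m₂ u p‖ ≤ lip * dev u := by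
  intro u hu p hp
  have h := hL u hu p hp
  rwa [h0 p hp, sub_zero] at h

end PairMeanField

/-! ## §2 (K10)  Second-cumulant booking of a centred bounded perturbation -/

section Cumulant

variable {X : Type*} [MeasurableSpace X] {μ : Measure X}

/-- A pointwise bounded strongly measurable real function on a finite-measure space is integrable. [folklore] -/
theorem integrable_of_abs_le [IsFiniteMeasure μ] {V : X → ℝ} (hVm : AEStronglyMeasurable V μ) {C : ℝ}
    (hV : ∀ x, |V x| ≤ C) : Integrable V μ :=
  Integrable.mono' (integrable_const C) hVm (Filter.Eventually.of_forall fun x => by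
    simpa [Real.norm_eq_abs] using hV x)

variable [IsProbabilityMeasure μ] {V : X → ℝ}

/-- `exp(−V)` is integrable when `|V| ≤ 1` (it is bounded by `exp 1`). [folklore] -/
theorem integrable_exp_neg (hVm : AEStronglyMeasurable V μ) (hV : ∀ x, |V x| ≤ 1) :
    Integrable (fun x => Real.exp (-V x)) μ := by
  refine integrable_of_abs_le (Real.continuous_exp.comp_aestronglyMeasurable (hVm.neg)) (C := Real.exp 1) fun x => ?_
  rw [abs_of_pos (Real.exp_pos _)]
  exact Real.exp_le_exp.mpr (by have := (abs_le.mp (hV x)).1; linarith)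

/-- JENSEN HALF: `∫ V = 0 ⇒ 1 ≤ ∫ exp(−V) ∂μ`. [folklore] -/
theorem one_le_integral_exp_neg (hVm : AEStronglyMeasurable V μ) (hV : ∀ x, |V x| ≤ 1) (h0 : ∫ x, V x ∂μ = 0) :
    1 ≤ ∫ x, Real.exp (-V x) ∂μ := by
  have hVi : Integrable V μ := integrable_of_abs_le hVm hV
  calc (1 : ℝ) = ∫ x, (1 - V x) ∂μ := by
        rw [integral_sub (integrable_const 1) hVi, h0, integral_const]; simp
    _ ≤ ∫ x, Real.exp (-V x) ∂μ :=
        integral_mono ((integrable_const 1).sub hVi) (integrable_exp_neg hVm hV) fun x => by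
          -- `1 − v ≤ exp(−v)` (`Real.add_one_le_exp`; the named twins elsewhere in the tree are not importable here)
          have := Real.add_one_le_exp (-V x); simp only; linarith

/-- TAYLOR HALF: `|V| ≤ 1, ∫ V = 0 ⇒ ∫ exp(−V) ∂μ ≤ 1 + ∫ V² ∂μ`. [folklore] -/
theorem integral_exp_neg_le (hVm : AEStronglyMeasurable V μ) (hV : ∀ x, |V x| ≤ 1) (h0 : ∫ x, V x ∂μ = 0) :
    ∫ x, Real.exp (-V x) ∂μ ≤ 1 + ∫ x, V x ^ 2 ∂μ := by
  have hVi : Integrable V μ := integrable_of_abs_le hVm hV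
  have hV2 : Integrable (fun x => V x ^ 2) μ := by
    refine integrable_of_abs_le (hVm.pow 2) (C := 1) fun x => ?_
    rw [abs_of_nonneg (sq_nonneg _)]
    have := hV x
    have h1 : |V x| ^ 2 ≤ 1 := by nlinarith [abs_nonneg (V x)]
    simpa [sq_abs] using h1
  calc ∫ x, Real.exp (-V x) ∂μ ≤ ∫ x, (1 - V x + V x ^ 2) ∂μ :=
        integral_mono (integrable_exp_neg hVm hV) (((integrable_const 1).sub hVi).add hV2)
          fun x => by
            -- `exp(−v) ≤ 1 − v + v²` for `|v| ≤ 1` (`Real.abs_exp_sub_one_sub_id_le`; cf. the twin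
            -- `Literature.Probability.RandomMatrixProducts.exp_neg_le_one_sub_add_sq`, not imported)
            have h := Real.abs_exp_sub_one_sub_id_le (x := -V x) (by simpa using hV x)
            have h' := (abs_le.mp h).2
            simp only; nlinarith [h']
    _ = 1 + ∫ x, V x ^ 2 ∂μ := by
        have h1V : Integrable (fun x => (1 : ℝ) - V x) μ := (integrable_const 1).sub hVi
        rw [integral_add h1V hV2, integral_sub (integrable_const 1) hVi, h0, integral_const]
        simp

/-- **(K10) lower half**: `0 ≤ log ∫ exp(−V) ∂μ` for a centred `|V| ≤ 1`. [folklore] -/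
theorem log_integral_exp_neg_nonneg (hVm : AEStronglyMeasurable V μ) (hV : ∀ x, |V x| ≤ 1)
    (h0 : ∫ x, V x ∂μ = 0) : 0 ≤ Real.log (∫ x, Real.exp (-V x) ∂μ) :=
  Real.log_nonneg (one_le_integral_exp_neg hVm hV h0)

/-- **(K10) SECOND-CUMULANT BOOKING**: for a probability law `μ` and a centred perturbation `V` with `|V| ≤ 1`,
`log ∫ exp(−V) ∂μ ≤ ∫ V² ∂μ` — a centred first-order-sized term moves `−log ∫ e^{−V}` only at second order (its
second moment), never at its sup.  Apply with `μ` = the conditional law at a fixed exterior. [folklore] -/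
theorem log_integral_exp_neg_le_sq (hVm : AEStronglyMeasurable V μ) (hV : ∀ x, |V x| ≤ 1)
    (h0 : ∫ x, V x ∂μ = 0) : Real.log (∫ x, Real.exp (-V x) ∂μ) ≤ ∫ x, V x ^ 2 ∂μ := by
  have h1 := one_le_integral_exp_neg hVm hV h0
  have h2 := integral_exp_neg_le hVm hV h0
  have hpos : 0 < ∫ x, Real.exp (-V x) ∂μ := by linarith
  have := Real.log_le_sub_one_of_pos hpos
  linarith

/-- (K10) two-sided, absolute form: `|log ∫ exp(−V) ∂μ| ≤ ∫ V² ∂μ`. [folklore] -/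
theorem abs_log_integral_exp_neg_le_sq (hVm : AEStronglyMeasurable V μ) (hV : ∀ x, |V x| ≤ 1)
    (h0 : ∫ x, V x ∂μ = 0) : |Real.log (∫ x, Real.exp (-V x) ∂μ)| ≤ ∫ x, V x ^ 2 ∂μ := by
  rw [abs_of_nonneg (log_integral_exp_neg_nonneg hVm hV h0)]
  exact log_integral_exp_neg_le_sq hVm hV h0

end Cumulant

/-! ## §3 (K11)  The two booking lines of Q17 (a) -/

section Lines

open Literature.MathematicalPhysics.QuantumFieldTheory.Balaban1983to89.T4GatedBooking

/-- **(K11c) THE GAIN LINE** (= the two-rate line of `T4PreservedUnderT.sum_count_twoRate_le`, restated WITHOUT a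
`Booking` structure): counts `N j ≤ N₀Λ^{k−j}` for `j ≤ k ≤ K`, sizes `A·φ^{k−j}·τ^{K−j}` with `0 ≤ τ ≤ 1` and a STRICT
product `Λφτ ≤ r < 1` give `Σ_{j ≤ k} N j·(Aφ^{k−j}τ^{K−j}) ≤ N₀A/(1−r)`, uniformly in `k` and `K`. [folklore] -/
theorem gainLine_le {N : ℕ → ℝ} {N₀ A Λ φ τ r : ℝ} {K k : ℕ} (hk : k ≤ K)
    (hNle : ∀ j, j ≤ k → N j ≤ N₀ * Λ ^ (k - j)) (hN₀ : 0 ≤ N₀) (hA : 0 ≤ A) (hΛ : 0 ≤ Λ) (hφ : 0 ≤ φ)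
    (hτ0 : 0 ≤ τ) (hτ1 : τ ≤ 1) (hr : Λ * φ * τ ≤ r) (hr1 : r < 1) :
    ∑ j ∈ range (k + 1), N j * (A * φ ^ (k - j) * τ ^ (K - j)) ≤ N₀ * A / (1 - r) := by
  have hΛφτ : 0 ≤ Λ * φ * τ := mul_nonneg (mul_nonneg hΛ hφ) hτ0
  refine sum_count_mul_size_le_geom (N := fun j _ => N j) (σ := fun j _ => A * φ ^ (k - j) * τ ^ (K - j))
    (mul_nonneg hN₀ hA) (hΛφτ.trans hr) hr1 fun j hj => ?_
  have e : K - j = (K - k) + (k - j) := by omega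
  calc N j * (A * φ ^ (k - j) * τ ^ (K - j)) ≤ (N₀ * Λ ^ (k - j)) * (A * φ ^ (k - j) * τ ^ (K - j)) :=
        mul_le_mul_of_nonneg_right (hNle j hj)
          (mul_nonneg (mul_nonneg hA (pow_nonneg hφ _)) (pow_nonneg hτ0 _))
    _ = (N₀ * A * τ ^ (K - k)) * (Λ * φ * τ) ^ (k - j) := by
        rw [e, pow_add, mul_pow, mul_pow]; ring
    _ ≤ (N₀ * A * 1) * r ^ (k - j) :=
        mul_le_mul (mul_le_mul_of_nonneg_left (pow_le_one₀ hτ0 hτ1) (mul_nonneg hN₀ hA))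
          (pow_le_pow_left₀ hΛφτ hr _) (pow_nonneg hΛφτ _) (mul_nonneg (mul_nonneg hN₀ hA) zero_le_one)
    _ = N₀ * A * r ^ (k - j) := by ring

/-- **(K11a) THE VARIANCE LINE IS GAIN-FREE**: per-pair SECOND moments `A·(τ²)^{K−j}` against the same counts are
K-uniform as soon as `Λτ² ≤ r < 1`, with NO per-step gain (`φ = 1`).  Cell values: `Λ = L⁴`, `τ = θ₁ = L⁻³`,
`Λτ² = L⁻² < 1` — Q17 (a)'s summable line `(L⁴θ₁²)^{K−j} = L^{−2(K−j)}`. [folklore] -/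
theorem varianceLine_le {N : ℕ → ℝ} {N₀ A Λ τ r : ℝ} {K k : ℕ} (hk : k ≤ K)
    (hNle : ∀ j, j ≤ k → N j ≤ N₀ * Λ ^ (k - j)) (hN₀ : 0 ≤ N₀) (hA : 0 ≤ A) (hΛ : 0 ≤ Λ)
    (hτ0 : 0 ≤ τ) (hτ1 : τ ≤ 1) (hr : Λ * τ ^ 2 ≤ r) (hr1 : r < 1) :
    ∑ j ∈ range (k + 1), N j * (A * (τ ^ 2) ^ (K - j)) ≤ N₀ * A / (1 - r) := by
  have h := gainLine_le (N := N) (A := A) (K := K) hk hNle hN₀ hA hΛ zero_le_one (pow_nonneg hτ0 2)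
    (pow_le_one₀ hτ0 hτ1) (by simpa using hr) hr1
  simpa using h

/-- **(K11b) THE SUP LINE WITHOUT GAIN DIVERGES**: per-item FIRST-order sizes `A·τ^{K−j}` with NO per-step gain and
`Λτ ≥ 1` (cell values `Λτ = L⁴·L⁻³ = L`), against counts EQUAL to `N₀Λ^{k−j}`, have partial sums
`≥ (k+1)·N₀Aτ^{K−k}` — each of the `k+1` birth levels contributes at least the top-level amount. [folklore] -/
theorem supLine_ge {N₀ A Λ τ : ℝ} {K k : ℕ} (hk : k ≤ K) (hN₀ : 0 ≤ N₀) (hA : 0 ≤ A) (hτ0 : 0 ≤ τ)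
    (hΛτ : 1 ≤ Λ * τ) :
    (k + 1 : ℝ) * (N₀ * A * τ ^ (K - k)) ≤ ∑ j ∈ range (k + 1), (N₀ * Λ ^ (k - j)) * (A * τ ^ (K - j)) := by
  have hterm : ∀ j ∈ range (k + 1), N₀ * A * τ ^ (K - k) ≤ (N₀ * Λ ^ (k - j)) * (A * τ ^ (K - j)) := by
    intro j hj
    have hj' : j ≤ k := Nat.lt_succ_iff.mp (mem_range.mp hj)
    have e : K - j = (K - k) + (k - j) := by omega
    have h1 : (1 : ℝ) ≤ (Λ * τ) ^ (k - j) := one_le_pow₀ hΛτ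
    calc N₀ * A * τ ^ (K - k) = (N₀ * A * τ ^ (K - k)) * 1 := by ring
      _ ≤ (N₀ * A * τ ^ (K - k)) * (Λ * τ) ^ (k - j) :=
          mul_le_mul_of_nonneg_left h1 (mul_nonneg (mul_nonneg hN₀ hA) (pow_nonneg hτ0 _))
      _ = (N₀ * Λ ^ (k - j)) * (A * τ ^ (K - j)) := by rw [e, pow_add, mul_pow]; ring
  have := Finset.card_nsmul_le_sum (range (k + 1)) _ _ hterm
  simpa [card_range, nsmul_eq_mul] using this

/-- (K11b) AT THE TOP CUBE `k = K`: the gain-free sup line is `≥ (K+1)·N₀A` — unbounded in the number of levels `K`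
(hazard H-O3b-pair's arithmetic, for any booking that sups the co-read channel level by level without a flatness gain).
[folklore] -/
theorem supLine_top_ge {N₀ A Λ τ : ℝ} (K : ℕ) (hN₀ : 0 ≤ N₀) (hA : 0 ≤ A) (hτ0 : 0 ≤ τ) (hΛτ : 1 ≤ Λ * τ) :
    (K + 1 : ℝ) * (N₀ * A) ≤ ∑ j ∈ range (K + 1), (N₀ * Λ ^ (K - j)) * (A * τ ^ (K - j)) := by
  simpa using supLine_ge (K := K) (k := K) le_rfl hN₀ hA hτ0 hΛτ

/-- NUMERIC INSTANCE of the cell's values at `L = 2`: `Λ = 16`, `τ = θ₁ = 1/8`: the variance product `Λτ² = 1/4 < 1`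
(gain-free uniform) while the sup product `Λτ = 2 ≥ 1` (gain-free divergent). [arith] [folklore] -/
theorem cellValues_L2 : (16 : ℝ) * (1 / 8) ^ 2 < 1 ∧ (1 : ℝ) ≤ 16 * (1 / 8) := by norm_num

/-- The same at `L = 3`: `Λ = 81`, `τ = 1/27`: `Λτ² = 1/9 < 1`, `Λτ = 3 ≥ 1`. [arith] [folklore] -/
theorem cellValues_L3 : (81 : ℝ) * (1 / 27) ^ 2 < 1 ∧ (1 : ℝ) ≤ 81 * (1 / 27) := by norm_num

end Lines

end Literature.MathematicalPhysics.QuantumFieldTheory.Balaban1983to89.T4CoReadMoment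

end
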